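import Mathlib.Analysis.SpecialFunctions.Trigonometric.Basic
import Mathlib.Algebra.Order.Floor.Defs
import Mathlib.Order.Fin.Basic
import HarnessLib

/-!
# Pólya's sign-change theorem by the moment method — the block count (PieceA, §5)

Topic `Literature/NumberTheory/LFunctions` (namespace `Literature.NumberTheory.LFunctions`,
grouping sub-namespace `PolyaSignChanges`).  Part of the A1 formalisation of
`PolyaSignChanges.Grosswald1967_thmB` (cell pub/rh-inputs, PieceA: skeleton stub `stub_blocks`).
Elementary real analysis only.  Nothing in this file bears on the truth of RH.

## Content (proved, sorry-free)

* `stub_blocks` (skeleton signature): if a real sequence `a k` has the sign of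
  `cos((m+k)φ + α)` whenever `k₀ ≤ k ≤ K` and `|cos((m+k)φ + α)| ≥ 1/2`, where `0 < φ < π/2`,
  then `a` has an alternating index chain below `K` of length `≥ φK/π − φk₀/π − 3`.
  Proof: the phases `ψ_k = (m+k)φ + α` step by `φ < 2π/3`, so every arc
  `[jπ − π/3, jπ + π/3]` between `ψ_{k₀}` and `ψ_K` contains some `ψ_{k(j)}`
  (`k(j) = max(k₀, ⌈(jπ − π/3 − α)/φ − m⌉)`), on which `(-1)^j cos ψ ≥ 1/2`; consecutive `j`
  give strictly increasing indices with `a`-values of opposite signs.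

## References

* E. Grosswald, *Oscillation theorems of arithmetical functions*, TAMS 126 (1967) 1–28, §4 Thm B.
  [Grosswald1967]
-/

noncomputable section

namespace Literature.NumberTheory.LFunctions

namespace PolyaSignChanges

/-- **`stub_blocks`** (skeleton signature).  Counting: if a real sequence `a k` has the sign of
`cos((m+k)φ + α)` whenever `k₀ ≤ k ≤ K` and `|cos((m+k)φ+α)| ≥ 1/2`, with `0 < φ < π/2` (so every
arc `|cos| ≥ 1/2`, of length `2π/3 > φ`, is visited), then it has an alternating index chain of
length `≥ φ K/π − φ k₀/π − 3` below `K`. [cite: Grosswald1967, §4 Thm B (moment method: block count)] -/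
theorem stub_blocks (a : ℕ → ℝ) (m k₀ K : ℕ) (φ α : ℝ) (hφ : 0 < φ) (hφ' : φ < Real.pi / 2)
    (hsign : ∀ k : ℕ, k₀ ≤ k → k ≤ K → 1 / 2 ≤ |Real.cos ((m + k : ℝ) * φ + α)| →
      0 < Real.cos ((m + k : ℝ) * φ + α) * a k) :
    ∃ (n : ℕ) (κ : Fin (n + 1) → ℕ), StrictMono κ ∧ (∀ i, κ i ≤ K) ∧
      (∀ i : Fin n, a (κ i.castSucc) * a (κ i.succ) < 0) ∧
      φ * K / Real.pi - φ * k₀ / Real.pi - 3 ≤ n := by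
  have hπ := Real.pi_pos
  -- Step 0: normalise the phase to `0 ≤ α` (cosine is `2π`-periodic)
  wlog hα : 0 ≤ α generalizing α
  · set α' : ℝ := α - (⌊α / (2 * Real.pi)⌋ : ℝ) * (2 * Real.pi) with hα'
    have hα'0 : 0 ≤ α' := by
      have h1 := Int.floor_le (α / (2 * Real.pi))
      have h2 : (⌊α / (2 * Real.pi)⌋ : ℝ) * (2 * Real.pi) ≤ α := by
        rwa [le_div_iff₀ (by positivity)] at h1
      rw [hα']; linarith
    have hcos : ∀ k : ℕ, Real.cos ((m + k : ℝ) * φ + α') = Real.cos ((m + k : ℝ) * φ + α) := by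
      intro k
      rw [hα', show (m + k : ℝ) * φ + (α - (⌊α / (2 * Real.pi)⌋ : ℝ) * (2 * Real.pi)) =
        ((m + k : ℝ) * φ + α) - (⌊α / (2 * Real.pi)⌋ : ℝ) * (2 * Real.pi) by ring,
        Real.cos_sub_int_mul_two_pi]
    exact this α' (fun k hk hkK hc => by rw [hcos] at hc ⊢; exact hsign k hk hkK hc) hα'0
  -- phases, arcs and the index selection `kk j`
  set ψ : ℕ → ℝ := fun k => (m + k : ℝ) * φ + α with hψ
  have hψ_mono : StrictMono ψ := fun i j hij => by
    have : (i : ℝ) < j := Nat.cast_lt.2 hij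
    simp only [hψ]; nlinarith
  have hψ0 : ∀ k, 0 ≤ ψ k := fun k => by simp only [hψ]; positivity
  set t : ℕ → ℝ := fun j => ((j : ℝ) * Real.pi - Real.pi / 3 - α) / φ - m with ht
  set kk : ℕ → ℕ := fun j => max k₀ ⌈t j⌉₊ with hkk
  have hkk₀ : ∀ j, k₀ ≤ kk j := fun j => le_max_left _ _
  have htψ : ∀ (j : ℕ) (s : ℝ), (m + s) * φ + α = (j : ℝ) * Real.pi - Real.pi / 3 + (s - t j) * φ := by
    intro j s; simp only [ht]; field_simp; ring
  have F1 : ∀ j : ℕ, (j : ℝ) * Real.pi - Real.pi / 3 ≤ ψ (kk j) := by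
    intro j
    have h1 : t j ≤ (kk j : ℝ) :=
      (Nat.le_ceil (t j)).trans (by exact_mod_cast le_max_right _ _)
    have h2 : ψ (kk j) = (j : ℝ) * Real.pi - Real.pi / 3 + ((kk j : ℝ) - t j) * φ := htψ j _
    rw [h2]; nlinarith
  set aa : ℝ := (ψ k₀ - Real.pi / 3) / Real.pi with haa
  set bb : ℝ := (ψ K + Real.pi / 3) / Real.pi with hbb
  set J₀ : ℕ := ⌈aa⌉₊ with hJ₀
  set J₁ : ℕ := ⌊bb⌋₊ with hJ₁
  have hbb0 : 0 ≤ bb := by positivity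
  have haa_low : -(1 / 3 : ℝ) ≤ aa := by
    rw [haa, le_div_iff₀ hπ]; linarith [hψ0 k₀]
  have hkey : φ * K / Real.pi - φ * k₀ / Real.pi = bb - aa - 2 / 3 := by
    simp only [haa, hbb, hψ]; field_simp; ring
  have hJ₀ψ : ∀ j : ℕ, J₀ ≤ j → ψ k₀ ≤ (j : ℝ) * Real.pi + Real.pi / 3 := by
    intro j hj
    have : aa ≤ j := Nat.ceil_le.1 hj
    rw [haa, div_le_iff₀ hπ] at this; linarith
  have F2 : ∀ j : ℕ, J₀ ≤ j → ψ (kk j) ≤ (j : ℝ) * Real.pi + Real.pi / 3 := by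
    intro j hj
    rcases le_or_gt ⌈t j⌉₊ k₀ with h | h
    · have : kk j = k₀ := max_eq_left h
      rw [this]; exact hJ₀ψ j hj
    · have hkj : kk j = ⌈t j⌉₊ := max_eq_right h.le
      have ht0 : 0 < t j := Nat.ceil_pos.1 (by omega)
      have h2 : (⌈t j⌉₊ : ℝ) < t j + 1 := Nat.ceil_lt_add_one ht0.le
      have h3 : ψ (kk j) = (j : ℝ) * Real.pi - Real.pi / 3 + ((kk j : ℝ) - t j) * φ := htψ j _
      have h4 : ((kk j : ℝ) - t j) * φ < 1 * φ := by
        rw [hkj]; exact mul_lt_mul_of_pos_right (by linarith) hφ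
      rw [h3]; linarith
  have F3 : ∀ j : ℕ, j ≤ J₁ → k₀ ≤ K → kk j ≤ K := by
    intro j hj hk
    refine max_le hk (Nat.ceil_le.2 ?_)
    have h1 : (j : ℝ) ≤ bb := (Nat.le_floor_iff hbb0).1 hj
    rw [hbb, le_div_iff₀ hπ] at h1
    have h2 : ψ K = (j : ℝ) * Real.pi - Real.pi / 3 + ((K : ℝ) - t j) * φ := htψ j _
    by_contra h3
    push Not at h3
    have : ((K : ℝ) - t j) * φ < 0 := mul_neg_of_neg_of_pos (by linarith) hφ
    linarith
  have F4 : ∀ j : ℕ, J₀ ≤ j → kk j < kk (j + 1) := by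
    intro j hj
    by_contra hle
    push Not at hle
    have h1 := F1 (j + 1)
    have h2 := F2 j hj
    have h3 : ψ (kk (j + 1)) ≤ ψ (kk j) := hψ_mono.monotone hle
    push_cast at h1
    linarith
  have F5 : ∀ j : ℕ, J₀ ≤ j → 1 / 2 ≤ (-1) ^ j * Real.cos (ψ (kk j)) := by
    intro j hj
    set δ := ψ (kk j) - j * Real.pi with hδ_def
    have hδ : |δ| ≤ Real.pi / 3 := abs_le.2 ⟨by linarith [F1 j], by linarith [F2 j hj]⟩
    have h1 : Real.cos (ψ (kk j)) = (-1) ^ j * Real.cos δ := by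
      rw [show ψ (kk j) = δ + j * Real.pi by rw [hδ_def]; ring, Real.cos_add_nat_mul_pi]
    rw [h1, ← mul_assoc, ← pow_add, ← two_mul, pow_mul, neg_one_sq, one_pow, one_mul,
      ← Real.cos_abs, ← Real.cos_pi_div_three]
    exact Real.cos_le_cos_of_nonneg_of_le_pi (abs_nonneg _) (by linarith) hδ
  have F5' : ∀ j : ℕ, J₀ ≤ j → 1 / 2 ≤ |Real.cos ((m + kk j : ℝ) * φ + α)| := by
    intro j hj
    have h1 := F5 j hj
    have h2 : (-1 : ℝ) ^ j * Real.cos (ψ (kk j)) ≤ |Real.cos (ψ (kk j))| := by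
      calc (-1 : ℝ) ^ j * Real.cos (ψ (kk j)) ≤ |(-1 : ℝ) ^ j * Real.cos (ψ (kk j))| :=
            le_abs_self _
        _ = |Real.cos (ψ (kk j))| := by rw [abs_mul, abs_pow, abs_neg, abs_one, one_pow, one_mul]
    exact h1.trans h2
  have F6 : ∀ j : ℕ, J₀ ≤ j → j + 1 ≤ J₁ → k₀ ≤ K → a (kk j) * a (kk (j + 1)) < 0 := by
    intro j hj hj1 hk
    have c1 := F5 j hj
    have c2 := F5 (j + 1) (by omega)
    have s1 := hsign (kk j) (hkk₀ j) (F3 j (by omega) hk) (F5' j hj)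
    have s2 := hsign (kk (j + 1)) (hkk₀ (j + 1)) (F3 (j + 1) hj1 hk) (F5' (j + 1) (by omega))
    change 0 < Real.cos (ψ (kk j)) * a (kk j) at s1
    change 0 < Real.cos (ψ (kk (j + 1))) * a (kk (j + 1)) at s2
    rw [pow_succ] at c2
    have hsq : ((-1 : ℝ) ^ j) ^ 2 = 1 := by
      rw [← pow_mul, mul_comm, pow_mul, neg_one_sq, one_pow]
    have hcc : Real.cos (ψ (kk j)) * Real.cos (ψ (kk (j + 1))) < 0 := by nlinarith
    have hprod := mul_pos s1 s2
    nlinarith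
  -- the chain
  by_cases hmain : J₀ ≤ J₁ ∧ k₀ ≤ K
  · obtain ⟨hJ, hk⟩ := hmain
    refine ⟨J₁ - J₀, fun i => kk (J₀ + i), ?_, ?_, ?_, ?_⟩
    · refine Fin.strictMono_iff_lt_succ.2 fun i => ?_
      simp only [Fin.val_castSucc, Fin.val_succ, ← add_assoc]
      exact F4 (J₀ + i) (Nat.le_add_right _ _)
    · intro i
      exact F3 _ (by have := i.isLt; omega) hk
    · intro i
      simp only [Fin.val_castSucc, Fin.val_succ, ← add_assoc]
      exact F6 (J₀ + i) (Nat.le_add_right _ _) (by have := i.isLt; omega) hk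
    · have hJ₁ : bb - 1 < J₁ := by have := Nat.lt_floor_add_one bb; linarith
      rw [Nat.cast_sub hJ]
      by_cases ha : 0 ≤ aa
      · have hJ₀ : (J₀ : ℝ) < aa + 1 := Nat.ceil_lt_add_one ha
        linarith
      · have hJ₀ : J₀ = 0 := Nat.ceil_eq_zero.2 (le_of_lt (not_le.1 ha))
        rw [hJ₀, Nat.cast_zero]
        linarith
  · refine ⟨0, fun _ => 0, fun i j h => absurd h (by rw [Fin.lt_def]; omega), fun _ => Nat.zero_le _,
      fun i => i.elim0, ?_⟩
    rw [Nat.cast_zero]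
    rcases not_and_or.1 hmain with h | h
    · have h1 : J₁ + 1 ≤ J₀ := by omega
      have h1' : (J₁ : ℝ) + 1 ≤ J₀ := by exact_mod_cast h1
      have hJ₁ : bb - 1 < J₁ := by have := Nat.lt_floor_add_one bb; linarith
      by_cases ha : 0 ≤ aa
      · have hJ₀ : (J₀ : ℝ) < aa + 1 := Nat.ceil_lt_add_one ha
        linarith
      · have hJ₀ : J₀ = 0 := Nat.ceil_eq_zero.2 (le_of_lt (not_le.1 ha))
        omega
    · have h1 : (K : ℝ) < k₀ := by exact_mod_cast not_le.1 h
      have h2 : φ * K / Real.pi < φ * k₀ / Real.pi :=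
        div_lt_div_of_pos_right (mul_lt_mul_of_pos_left h1 hφ) hπ
      linarith

end PolyaSignChanges

end Literature.NumberTheory.LFunctions

end
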